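import Literature.NumberTheory.CubicFields.CubicFieldDiscriminant14891Primes
import HarnessLib

/-!
# The cubic field of discriminant `−14891` (LMFDB 3.1.14891.1), part 3: the primes above `13 ≤ p ≤ 31` are principal; CLASS NUMBER ONE — PROVED

Sequel of `CubicFieldDiscriminant14891Primes.lean` (part 2: `θ`-relation and the primes above `p ≤ 11`) and `CubicFieldDiscriminant14891.lean` (same seat, same namespace `Literature.NumberTheory.CubicFields.CubicDisc14891`; §1–§2 there: the polynomial,
`d_F = −14891`, `𝓞_F = ℤ[θ]`, signature).  THEOREMS ONLY; every statement PROVED.  §3: every prime of `𝓞_F` above `p ≤ 34` with `p^f ≤ 34` is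
principal (explicit generators / inert primes, Dedekind–Kummer); §4: ★ `h_F = 1` by Minkowski (`(4/π)(3!/3³)√14891 ≈ 34.53 < 35`) and
`not_two_dvd_classNumber`.  Written by the prover seat `bsd-line-att-p4` g38 (cell `bsd-f1-sign2`; g27's template) for the curve `[1,0,0,−122,−529]` of conductor
`14891 (prime)` on the doors-dead sub-cell (u1/u7) of crux C2 — the datum «`h(ℚ(β)) = 1`» of att-p3's / att-p5's class-group doors.

References: [LMFDB] number field 3.1.14891.1 (class number 1); [Marcus2018] Ch. 3 Thm. 27, Ch. 5 Thm. 37 and Cor. 2.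
-/

noncomputable section

open Polynomial NumberField NumberField.InfinitePlace Ideal Module Real
open Literature.NumberTheory.NumberFields
open Literature.NumberTheory.NumberFields.MonicCubic

namespace Literature.NumberTheory.CubicFields.CubicDisc14891

section NumberField

variable {F : Type*} [Field F] [NumberField F] {α : F}

/-- The cubic relation `θ³ + aθ² + bθ + c = 0` in `𝓞_F`, numerals pushed (private helper). [folklore] -/
private theorem theta_rel' (hα : aeval α (poly (-7) (-9) (-8)) = 0) :
    thetaInt hα ^ 3 + (-7) * thetaInt hα ^ 2 + (-9) * thetaInt hα + (-8) = 0 := by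
  have h := thetaInt_rel hα
  push_cast at h
  linear_combination h

/-- `(13, θ + 2) = (115 - 14 * θ)` (an element of norm `±13`). [cite: Marcus2018, Ch. 3, Thm. 27] -/
theorem span_13_lin2_eq (hα : aeval α (poly (-7) (-9) (-8)) = 0) :
    span {(13 : 𝓞 F), thetaInt hα + 2} = span {115 - 14 * thetaInt hα} := by
  have hrel := theta_rel' hα
  apply le_antisymm
  · rw [span_le]
    rintro x hx
    rcases hx with rfl | hx
    · exact mem_span_singleton'.mpr ⟨191 + 238 * thetaInt hα + 196 * thetaInt hα ^ 2, by linear_combination (-2744) * hrel⟩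
    · rw [Set.mem_singleton_iff.mp hx]
      exact mem_span_singleton'.mpr ⟨150 + 187 * thetaInt hα + 154 * thetaInt hα ^ 2, by linear_combination (-2156) * hrel⟩
  · rw [span_singleton_le_iff_mem, mem_span_pair]
    exact ⟨11 + thetaInt hα ^ 2, -6 + 5 * thetaInt hα - 2 * thetaInt hα ^ 2, by linear_combination (-2) * hrel⟩

/-- **Every prime of `𝓞_F` above `13` with `13^f ≤ 34` is principal** (Dedekind–Kummer with `polyMod_13` and the generators above).
[cite: Marcus2018, Ch. 3, Thm. 27] [cite: LMFDB, number field 3.1.14891.1 (class number 1)] -/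
theorem isPrincipal_of_mem_primesOver_13 (h3 : finrank ℚ F = 3) (hα : aeval α (poly (-7) (-9) (-8)) = 0) {P : Ideal (𝓞 F)}
    (hP : P ∈ primesOver (span {((13 : ℕ) : ℤ)}) (𝓞 F))
    (hle : 13 ^ P.inertiaDeg ℤ ≤ 34) : Submodule.IsPrincipal P := by
  haveI : Fact (Nat.Prime 13) := ⟨by norm_num⟩
  obtain ⟨Qb, hirr, hmon, hdvd, hdeg, hspan⟩ :=
    exists_factor_of_mem_primesOver irreducible_polyQ hα h3 isUnit_of_disc_eq_sq_mul (by norm_num : Nat.Prime 13) hP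
  rw [polyMod_13] at hdvd
  rcases hirr.prime.dvd_or_dvd hdvd with h | h
  · have hirr1 : Irreducible (X + 2 : (ZMod 13)[X]) := by
      rw [show (X + 2 : (ZMod 13)[X]) = X - C (-2) by rw [map_neg, map_ofNat]; ring]
      exact irreducible_X_sub_C _
    have hQb : Qb = X + 2 := eq_of_monic_of_associated hmon (by monicity!) (hirr.associated_of_dvd hirr1 h)
    have hPeq := hspan (X + C 2) (by rw [hQb]; simp [map_ofNat])
    rw [show aeval (thetaInt hα) (X + C 2 : ℤ[X]) = thetaInt hα + 2 by
        simp only [map_add, aeval_X, aeval_C, algebraMap_int_eq, Int.coe_castRingHom, Int.cast_ofNat], Nat.cast_ofNat, span_13_lin2_eq hα] at hPeq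
    exact ⟨⟨115 - 14 * thetaInt hα, by rw [hPeq, Ideal.submodule_span_eq]⟩⟩
  · have hQb : Qb = X ^ 2 + 4 * X + 9 :=
      eq_of_monic_of_associated hmon (by monicity!) (hirr.associated_of_dvd CubicDisc3547.irreducible_quad_13 h)
    exfalso
    have hd2 : (X ^ 2 + 4 * X + 9 : (ZMod 13)[X]).natDegree = 2 := by compute_degree!
    rw [hdeg, hQb, hd2] at hle
    norm_num at hle

/-- `f` has no root modulo `17`: `17` is inert. [cite: Marcus2018, Ch. 3, Thm. 27] -/
theorem no_root_17' : ∀ r : ZMod 17, r ^ 3 + ((-7 : ℤ) : ZMod 17) * r ^ 2 + ((-9 : ℤ) : ZMod 17) * r + ((-8 : ℤ) : ZMod 17) ≠ 0 := by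
  decide

/-- **Every prime of `𝓞_F` above `17` is principal**: `17` is inert, the prime is `(17)`. [cite: Marcus2018, Ch. 3, Thm. 27] -/
theorem isPrincipal_of_mem_primesOver_17 (h3 : finrank ℚ F = 3) (hα : aeval α (poly (-7) (-9) (-8)) = 0) {P : Ideal (𝓞 F)}
    (hP : P ∈ primesOver (span {((17 : ℕ) : ℤ)}) (𝓞 F)) : Submodule.IsPrincipal P := by
  have hPeq := eq_span_of_no_root irreducible_polyQ hα h3 isUnit_of_disc_eq_sq_mul (by norm_num : Nat.Prime 17) hP no_root_17'
  exact ⟨⟨((17 : ℕ) : 𝓞 F), by rw [hPeq, Ideal.submodule_span_eq]⟩⟩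

/-- `f` has no root modulo `19`: `19` is inert. [cite: Marcus2018, Ch. 3, Thm. 27] -/
theorem no_root_19' : ∀ r : ZMod 19, r ^ 3 + ((-7 : ℤ) : ZMod 19) * r ^ 2 + ((-9 : ℤ) : ZMod 19) * r + ((-8 : ℤ) : ZMod 19) ≠ 0 := by
  decide

/-- **Every prime of `𝓞_F` above `19` is principal**: `19` is inert, the prime is `(19)`. [cite: Marcus2018, Ch. 3, Thm. 27] -/
theorem isPrincipal_of_mem_primesOver_19 (h3 : finrank ℚ F = 3) (hα : aeval α (poly (-7) (-9) (-8)) = 0) {P : Ideal (𝓞 F)}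
    (hP : P ∈ primesOver (span {((19 : ℕ) : ℤ)}) (𝓞 F)) : Submodule.IsPrincipal P := by
  have hPeq := eq_span_of_no_root irreducible_polyQ hα h3 isUnit_of_disc_eq_sq_mul (by norm_num : Nat.Prime 19) hP no_root_19'
  exact ⟨⟨((19 : ℕ) : 𝓞 F), by rw [hPeq, Ideal.submodule_span_eq]⟩⟩

/-- `(23, θ + 22) = (-1 + θ)` (an element of norm `±23`). [cite: Marcus2018, Ch. 3, Thm. 27] -/
theorem span_23_lin22_eq (hα : aeval α (poly (-7) (-9) (-8)) = 0) :
    span {(23 : 𝓞 F), thetaInt hα + 22} = span {-1 + thetaInt hα} := by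
  have hrel := theta_rel' hα
  apply le_antisymm
  · rw [span_le]
    rintro x hx
    rcases hx with rfl | hx
    · exact mem_span_singleton'.mpr ⟨-15 - 6 * thetaInt hα + thetaInt hα ^ 2, by linear_combination (1) * hrel⟩
    · rw [Set.mem_singleton_iff.mp hx]
      exact mem_span_singleton'.mpr ⟨-14 - 6 * thetaInt hα + thetaInt hα ^ 2, by linear_combination (1) * hrel⟩
  · rw [span_singleton_le_iff_mem, mem_span_pair]
    exact ⟨7 - 12 * thetaInt hα - 13 * thetaInt hα ^ 2, -11 + 9 * thetaInt hα + 10 * thetaInt hα ^ 2, by linear_combination (10) * hrel⟩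

/-- `(23, θ + 21) = (-3 - 4 * θ - 3 * θ ^ 2)` (an element of norm `±23`). [cite: Marcus2018, Ch. 3, Thm. 27] -/
theorem span_23_lin21_eq (hα : aeval α (poly (-7) (-9) (-8)) = 0) :
    span {(23 : 𝓞 F), thetaInt hα + 21} = span {-3 - 4 * thetaInt hα - 3 * thetaInt hα ^ 2} := by
  have hrel := theta_rel' hα
  apply le_antisymm
  · rw [span_le]
    rintro x hx
    rcases hx with rfl | hx
    · exact mem_span_singleton'.mpr ⟨75 + 73 * thetaInt hα - 10 * thetaInt hα ^ 2, by linear_combination (31 + 30 * thetaInt hα) * hrel⟩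
    · rw [Set.mem_singleton_iff.mp hx]
      exact mem_span_singleton'.mpr ⟨65 + 66 * thetaInt hα - 9 * thetaInt hα ^ 2, by linear_combination (27 + 27 * thetaInt hα) * hrel⟩
  · rw [span_singleton_le_iff_mem, mem_span_pair]
    exact ⟨12 - thetaInt hα + 7 * thetaInt hα ^ 2, -11 + 4 * thetaInt hα - 6 * thetaInt hα ^ 2, by linear_combination (-6) * hrel⟩

/-- `(23, θ + 19) = (27 + 46 * θ - 6 * θ ^ 2)` (an element of norm `±23`). [cite: Marcus2018, Ch. 3, Thm. 27] -/
theorem span_23_lin19_eq (hα : aeval α (poly (-7) (-9) (-8)) = 0) :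
    span {(23 : 𝓞 F), thetaInt hα + 19} = span {27 + 46 * thetaInt hα - 6 * thetaInt hα ^ 2} := by
  have hrel := theta_rel' hα
  apply le_antisymm
  · rw [span_le]
    rintro x hx
    rcases hx with rfl | hx
    · exact mem_span_singleton'.mpr ⟨21 + 26 * thetaInt hα + 22 * thetaInt hα ^ 2, by linear_combination (-68 - 132 * thetaInt hα) * hrel⟩
    · rw [Set.mem_singleton_iff.mp hx]
      exact mem_span_singleton'.mpr ⟨25 + 31 * thetaInt hα + 26 * thetaInt hα ^ 2, by linear_combination (-82 - 156 * thetaInt hα) * hrel⟩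
  · rw [span_singleton_le_iff_mem, mem_span_pair]
    exact ⟨12 - 3 * thetaInt hα + 5 * thetaInt hα ^ 2, -11 + 9 * thetaInt hα - 5 * thetaInt hα ^ 2, by linear_combination (-5) * hrel⟩

/-- **Every prime of `𝓞_F` above `23` is principal** (Dedekind–Kummer with `polyMod_23` and the generators above).
[cite: Marcus2018, Ch. 3, Thm. 27] [cite: LMFDB, number field 3.1.14891.1 (class number 1)] -/
theorem isPrincipal_of_mem_primesOver_23 (h3 : finrank ℚ F = 3) (hα : aeval α (poly (-7) (-9) (-8)) = 0) {P : Ideal (𝓞 F)}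
    (hP : P ∈ primesOver (span {((23 : ℕ) : ℤ)}) (𝓞 F)) : Submodule.IsPrincipal P := by
  haveI : Fact (Nat.Prime 23) := ⟨by norm_num⟩
  obtain ⟨Qb, hirr, hmon, hdvd, -, hspan⟩ :=
    exists_factor_of_mem_primesOver irreducible_polyQ hα h3 isUnit_of_disc_eq_sq_mul (by norm_num : Nat.Prime 23) hP
  rw [polyMod_23] at hdvd
  rcases hirr.prime.dvd_or_dvd hdvd with h12 | h
  · rcases hirr.prime.dvd_or_dvd h12 with h | h
    · have hirr1 : Irreducible (X + 22 : (ZMod 23)[X]) := by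
        rw [show (X + 22 : (ZMod 23)[X]) = X - C (-22) by rw [map_neg, map_ofNat]; ring]
        exact irreducible_X_sub_C _
      have hQb : Qb = X + 22 := eq_of_monic_of_associated hmon (by monicity!) (hirr.associated_of_dvd hirr1 h)
      have hPeq := hspan (X + C 22) (by rw [hQb]; simp [map_ofNat])
      rw [show aeval (thetaInt hα) (X + C 22 : ℤ[X]) = thetaInt hα + 22 by
          simp only [map_add, aeval_X, aeval_C, algebraMap_int_eq, Int.coe_castRingHom, Int.cast_ofNat], Nat.cast_ofNat, span_23_lin22_eq hα] at hPeq
      exact ⟨⟨-1 + thetaInt hα, by rw [hPeq, Ideal.submodule_span_eq]⟩⟩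
    · have hirr1 : Irreducible (X + 21 : (ZMod 23)[X]) := by
        rw [show (X + 21 : (ZMod 23)[X]) = X - C (-21) by rw [map_neg, map_ofNat]; ring]
        exact irreducible_X_sub_C _
      have hQb : Qb = X + 21 := eq_of_monic_of_associated hmon (by monicity!) (hirr.associated_of_dvd hirr1 h)
      have hPeq := hspan (X + C 21) (by rw [hQb]; simp [map_ofNat])
      rw [show aeval (thetaInt hα) (X + C 21 : ℤ[X]) = thetaInt hα + 21 by
          simp only [map_add, aeval_X, aeval_C, algebraMap_int_eq, Int.coe_castRingHom, Int.cast_ofNat], Nat.cast_ofNat, span_23_lin21_eq hα] at hPeq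
      exact ⟨⟨-3 - 4 * thetaInt hα - 3 * thetaInt hα ^ 2, by rw [hPeq, Ideal.submodule_span_eq]⟩⟩
  · have hirr1 : Irreducible (X + 19 : (ZMod 23)[X]) := by
      rw [show (X + 19 : (ZMod 23)[X]) = X - C (-19) by rw [map_neg, map_ofNat]; ring]
      exact irreducible_X_sub_C _
    have hQb : Qb = X + 19 := eq_of_monic_of_associated hmon (by monicity!) (hirr.associated_of_dvd hirr1 h)
    have hPeq := hspan (X + C 19) (by rw [hQb]; simp [map_ofNat])
    rw [show aeval (thetaInt hα) (X + C 19 : ℤ[X]) = thetaInt hα + 19 by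
        simp only [map_add, aeval_X, aeval_C, algebraMap_int_eq, Int.coe_castRingHom, Int.cast_ofNat], Nat.cast_ofNat, span_23_lin19_eq hα] at hPeq
    exact ⟨⟨27 + 46 * thetaInt hα - 6 * thetaInt hα ^ 2, by rw [hPeq, Ideal.submodule_span_eq]⟩⟩

/-- `(29, θ + 18) = (71 + 16 * θ - 3 * θ ^ 2)` (an element of norm `±29`). [cite: Marcus2018, Ch. 3, Thm. 27] -/
theorem span_29_lin18_eq (hα : aeval α (poly (-7) (-9) (-8)) = 0) :
    span {(29 : 𝓞 F), thetaInt hα + 18} = span {71 + 16 * thetaInt hα - 3 * thetaInt hα ^ 2} := by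
  have hrel := theta_rel' hα
  apply le_antisymm
  · rw [span_le]
    rintro x hx
    rcases hx with rfl | hx
    · exact mem_span_singleton'.mpr ⟨51 + 63 * thetaInt hα + 52 * thetaInt hα ^ 2, by linear_combination (-449 - 156 * thetaInt hα) * hrel⟩
    · rw [Set.mem_singleton_iff.mp hx]
      exact mem_span_singleton'.mpr ⟨46 + 57 * thetaInt hα + 47 * thetaInt hα ^ 2, by linear_combination (-406 - 141 * thetaInt hα) * hrel⟩
  · rw [span_singleton_le_iff_mem, mem_span_pair]
    exact ⟨15 + 6 * thetaInt hα + 12 * thetaInt hα ^ 2, -14 - thetaInt hα - 14 * thetaInt hα ^ 2, by linear_combination (-14) * hrel⟩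

/-- **Every prime of `𝓞_F` above `29` with `29^f ≤ 34` is principal** (Dedekind–Kummer with `polyMod_29` and the generators above).
[cite: Marcus2018, Ch. 3, Thm. 27] [cite: LMFDB, number field 3.1.14891.1 (class number 1)] -/
theorem isPrincipal_of_mem_primesOver_29 (h3 : finrank ℚ F = 3) (hα : aeval α (poly (-7) (-9) (-8)) = 0) {P : Ideal (𝓞 F)}
    (hP : P ∈ primesOver (span {((29 : ℕ) : ℤ)}) (𝓞 F))
    (hle : 29 ^ P.inertiaDeg ℤ ≤ 34) : Submodule.IsPrincipal P := by
  haveI : Fact (Nat.Prime 29) := ⟨by norm_num⟩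
  obtain ⟨Qb, hirr, hmon, hdvd, hdeg, hspan⟩ :=
    exists_factor_of_mem_primesOver irreducible_polyQ hα h3 isUnit_of_disc_eq_sq_mul (by norm_num : Nat.Prime 29) hP
  rw [polyMod_29] at hdvd
  rcases hirr.prime.dvd_or_dvd hdvd with h | h
  · have hirr1 : Irreducible (X + 18 : (ZMod 29)[X]) := by
      rw [show (X + 18 : (ZMod 29)[X]) = X - C (-18) by rw [map_neg, map_ofNat]; ring]
      exact irreducible_X_sub_C _
    have hQb : Qb = X + 18 := eq_of_monic_of_associated hmon (by monicity!) (hirr.associated_of_dvd hirr1 h)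
    have hPeq := hspan (X + C 18) (by rw [hQb]; simp [map_ofNat])
    rw [show aeval (thetaInt hα) (X + C 18 : ℤ[X]) = thetaInt hα + 18 by
        simp only [map_add, aeval_X, aeval_C, algebraMap_int_eq, Int.coe_castRingHom, Int.cast_ofNat], Nat.cast_ofNat, span_29_lin18_eq hα] at hPeq
    exact ⟨⟨71 + 16 * thetaInt hα - 3 * thetaInt hα ^ 2, by rw [hPeq, Ideal.submodule_span_eq]⟩⟩
  · have hQb : Qb = X ^ 2 + 4 * X + 6 :=
      eq_of_monic_of_associated hmon (by monicity!) (hirr.associated_of_dvd CubicDisc12163.irreducible_quad_29 h)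
    exfalso
    have hd2 : (X ^ 2 + 4 * X + 6 : (ZMod 29)[X]).natDegree = 2 := by compute_degree!
    rw [hdeg, hQb, hd2] at hle
    norm_num at hle

/-- `f` has no root modulo `31`: `31` is inert. [cite: Marcus2018, Ch. 3, Thm. 27] -/
theorem no_root_31' : ∀ r : ZMod 31, r ^ 3 + ((-7 : ℤ) : ZMod 31) * r ^ 2 + ((-9 : ℤ) : ZMod 31) * r + ((-8 : ℤ) : ZMod 31) ≠ 0 := by
  decide

/-- **Every prime of `𝓞_F` above `31` is principal**: `31` is inert, the prime is `(31)`. [cite: Marcus2018, Ch. 3, Thm. 27] -/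
theorem isPrincipal_of_mem_primesOver_31 (h3 : finrank ℚ F = 3) (hα : aeval α (poly (-7) (-9) (-8)) = 0) {P : Ideal (𝓞 F)}
    (hP : P ∈ primesOver (span {((31 : ℕ) : ℤ)}) (𝓞 F)) : Submodule.IsPrincipal P := by
  have hPeq := eq_span_of_no_root irreducible_polyQ hα h3 isUnit_of_disc_eq_sq_mul (by norm_num : Nat.Prime 31) hP no_root_31'
  exact ⟨⟨((31 : ℕ) : 𝓞 F), by rw [hPeq, Ideal.submodule_span_eq]⟩⟩

/-! ## §4 Class number one -/

/-- **`𝓞_F` is a principal ideal domain.**  Minkowski: every ideal class contains an ideal of norm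
`≤ (4/π)(6/27)√14891 < 35`, and the primes `P` above `p ≤ 34` with `p^f ≤ 34` are principal (§3).
[cite: LMFDB, number field 3.1.14891.1 (class number 1)] [cite: Marcus2018, Ch. 5, Thm. 37 and Cor. 2] -/
theorem isPrincipalIdealRing (h3 : finrank ℚ F = 3) (hα : aeval α (poly (-7) (-9) (-8)) = 0) : IsPrincipalIdealRing (𝓞 F) := by
  apply RingOfIntegers.isPrincipalIdealRing_of_isPrincipal_of_pow_le_of_mem_primesOver_of_mem_Icc
  rw [nrComplexPlaces_eq_one h3 hα, h3, discr_eq h3 hα]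
  intro p hp hpr P hP hle
  obtain ⟨hp1, hpM⟩ := Finset.mem_Icc.mp hp
  have hreal : (4 / π) ^ 1 * ((((3 : ℕ).factorial : ℕ) : ℝ) / ((3 : ℕ) : ℝ) ^ (3 : ℕ) * √|((-14891 : ℤ) : ℝ)|) < ((35 : ℕ) : ℝ) := by
    have hπ := Real.pi_gt_d2
    have hπ0 := Real.pi_pos
    have hs : √(14891 : ℝ) < 122.03 := by
      rw [Real.sqrt_lt' (by norm_num)]; norm_num
    have hs0 : 0 ≤ √(14891 : ℝ) := Real.sqrt_nonneg _
    have habs : |((-14891 : ℤ) : ℝ)| = 14891 := by norm_num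
    rw [habs]
    norm_num [Nat.factorial]
    rw [div_mul_eq_mul_div, div_lt_iff₀ hπ0]
    nlinarith
  have hfl := Nat.lt_succ_iff.mp ((Nat.floor_lt' (by norm_num)).mpr hreal)
  have hpB : p ≤ 34 := hpM.trans hfl
  have hleB : p ^ P.inertiaDeg ℤ ≤ 34 := hle.trans hfl
  clear hpM hle hp
  interval_cases p
  · exact absurd hpr (by norm_num)
  · exact isPrincipal_of_mem_primesOver_2 h3 hα hP
  · exact isPrincipal_of_mem_primesOver_3 h3 hα hP
  · exact absurd hpr (by norm_num)
  · exact isPrincipal_of_mem_primesOver_5 h3 hα hP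
  · exact absurd hpr (by norm_num)
  · exact isPrincipal_of_mem_primesOver_7 h3 hα hP hleB
  · exact absurd hpr (by norm_num)
  · exact absurd hpr (by norm_num)
  · exact absurd hpr (by norm_num)
  · exact isPrincipal_of_mem_primesOver_11 h3 hα hP
  · exact absurd hpr (by norm_num)
  · exact isPrincipal_of_mem_primesOver_13 h3 hα hP hleB
  · exact absurd hpr (by norm_num)
  · exact absurd hpr (by norm_num)
  · exact absurd hpr (by norm_num)
  · exact isPrincipal_of_mem_primesOver_17 h3 hα hP
  · exact absurd hpr (by norm_num)
  · exact isPrincipal_of_mem_primesOver_19 h3 hα hP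
  · exact absurd hpr (by norm_num)
  · exact absurd hpr (by norm_num)
  · exact absurd hpr (by norm_num)
  · exact isPrincipal_of_mem_primesOver_23 h3 hα hP
  · exact absurd hpr (by norm_num)
  · exact absurd hpr (by norm_num)
  · exact absurd hpr (by norm_num)
  · exact absurd hpr (by norm_num)
  · exact absurd hpr (by norm_num)
  · exact isPrincipal_of_mem_primesOver_29 h3 hα hP hleB
  · exact absurd hpr (by norm_num)
  · exact isPrincipal_of_mem_primesOver_31 h3 hα hP
  · exact absurd hpr (by norm_num)
  · exact absurd hpr (by norm_num)
  · exact absurd hpr (by norm_num)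

/-- ★ **`h_F = 1`: the cubic field of discriminant `−14891` has class number one.** [cite: LMFDB, number field 3.1.14891.1 (class number 1)] -/
theorem classNumber_eq_one (h3 : finrank ℚ F = 3) (hα : aeval α (poly (-7) (-9) (-8)) = 0) : classNumber F = 1 :=
  (classNumber_eq_one_iff (K := F)).mpr (isPrincipalIdealRing h3 hα)

/-- **`h_F` is odd** (the form consumed by the `2`-adic doors of cell `bsd-f1-sign2`). [cite: LMFDB, number field 3.1.14891.1 (class number 1)] -/
theorem not_two_dvd_classNumber (h3 : finrank ℚ F = 3) (hα : aeval α (poly (-7) (-9) (-8)) = 0) : ¬ 2 ∣ classNumber F := by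
  rw [classNumber_eq_one h3 hα]; decide

end NumberField

end Literature.NumberTheory.CubicFields.CubicDisc14891

end
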